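import Summits.HodgeConjecture.HodgeConjecture.Theorems.K2E4ArchPartnerWallJump   -- §2 there: the per-place partner jumps (compact ∕ noncompact), ★ (R1-e′)'s readings by import
import HarnessLib

/-!
# The one-step jump of the «method of §8.2» at a place `w`, ONE PARTNER AT A TIME, in all-places orbit-measure currency
# (Rogawski 1990 Prop. 8.2.1 (a) pp. 118–119, §8.2 pp. 122–124, §14.5 Lemma 14.5.2 (b) pp. 238–239)

Cell `pub/hodgecm-mathlib`, Track B «K2-LIT», engine K2·E4, sockets #11 `sig_K2E4ArchSingularKernel` ∕ #9 `sig_K2E4ExplicitArchSingularTransfer` (crux H413 =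
`stmt-HodgeConjecture-24833`); brick G1 (second half) of the V2 «G′ PACKAGE» (K2E4-p11 for the assembler K2E4-p09; lands `--supports stmt-HodgeConjecture-24833`).  Sequel of ★
`K2E4ArchPartnerWallJump`: ★ (R1-e′) `exists_tendsto_deriv_sin_mul_sum_integral_pi_update_splitCurve` run for ONE relabelling `ρ`, by wall type, with arbitrary Radon measures at the
other places — the per-partner `hstep` input of the κ-weighted `G′`-state family `B(S, u)` of the endoscopic singular transfer (jump coefficients `κ_w(ρ) = (cw ? 2 : c_{ρ⁻¹})` and
wall measures = ★ (R1-e′)'s, verbatim), together with the differentiability of the state on the window `ψ → 0+` that the flat-factor product rule (★ `K2E4ArchSingularKernelWallStepLemmas`)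
consumes.
* **`exists_const_tendsto_deriv_wallJump_partner_noncompact_orbitMeasure`** (noncompact `w`-wall of `ρ`: ONE constant `c ≠ 0` per partner, limit `c · I(μ[w ↦ μ^{sing}_ρ])`),
* **`tendsto_deriv_wallJump_partner_compact_orbitMeasure`** (compact: limit `2 · I(μ[w ↦ ν.map conj_{diag(z₀∘ρ)}])`).
HONEST LABEL: HC_CM is proved only modulo the 7 printed citations (2 remaining named inputs: hLiu418 = stmt-HodgeConjecture-24832, h413 = stmt-HodgeConjecture-24833) until rung 0
closes; this file re-threads ★ (R1-e′) and pays nothing by itself.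

## References
* [Rogawski1990] J. D. Rogawski, *Automorphic Representations of Unitary Groups in Three Variables*, Ann. of Math. Stud. 123 (1990), Prop. 8.2.1 (a) pp. 118–119, §8.2 pp. 122–124,
  §14.5 Lemma 14.5.2 (b) pp. 238–239.
* [Varadarajan1989] V. S. Varadarajan, *An Introduction to Harmonic Analysis on Semisimple Lie Groups* (1989), §6.4 Thm 22.
* [BorelJacquet1979] A. Borel, H. Jacquet, *Automorphic forms and automorphic representations*, PSPM 33.1 (1979), §4.1.
* [DeitmarEchterhoff2014] A. Deitmar, S. Echterhoff, *Principles of Harmonic Analysis*, 2nd ed. (2014), Lemma 9.3.3, Thm. 1.5.3.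
-/

set_option autoImplicit false
set_option linter.dupNamespace false  -- the cell's namespace convention `Summit.HodgeConjecture.HodgeConjecture.Cruxes.H413.<File>` repeats the summit = problem name

noncomputable section

open MeasureTheory Measure Filter Topology NumberField NumberField.InfinitePlace NumberField.mixedEmbedding Equiv Function Set
open Literature.MeasureTheory.Group Literature.NumberTheory.Automorphic Literature.NumberTheory.Automorphic.UnitaryGroup
open Literature.LinearAlgebra.Matrix Literature.NumberTheory.Rogawski1990
open Summit.HodgeConjecture.HodgeConjecture.Cruxes.H413.K2E4ArchPartnerWallJump
open scoped Matrix MatrixGroups Matrix.Norms.Operator ContDiff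

namespace Summit.HodgeConjecture.HodgeConjecture.Cruxes.H413.K2E4ArchPartnerWallJumpOrbitMeasure

/-! ## The one-step jump at `w` in all-places orbit-measure currency, one partner at a time -/

section Step

variable (L : Type) [Field L] [NumberField L] [IsCMField L] (α : Fin 3 → L) (w : {w : InfinitePlace L // IsComplex w})
  [MeasurableSpace (GL (Fin 3) ℂ)] [BorelSpace (GL (Fin 3) ℂ)]

open scoped Classical in
/-- **THE ONE-STEP JUMP OF ONE NONCOMPACT PARTNER AT `w`, ORBIT-MEASURE CURRENCY**: for every global test function `Θ`, every family `μ` of Radon measures on the `G_v`, every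
wall point `z₀` and every `ρ`: if the `w`-wall of `ρ` is NONCOMPACT: `∂_ψ [2 sin ψ · I(μ[w ↦ ν.map conj_{diag(γ_{z₀}(ψ)∘ρ)}])] ⟶ c_{ρ⁻¹} · I(μ[w ↦ μ^{sing}_ρ])` as `ψ → 0+` — ★ (R1-e′)'s proof run for one partner (constants `c` = §2's).  The κ-weighted `G′`-state family of the endoscopic singular transfer sums these with its own weights. [cite: Rogawski1990, §8.2 p. 124; §14.5 p. 238] [cite: Varadarajan1989, §6.4 Thm 22] [cite: BorelJacquet1979, §4.1] [cite: DeitmarEchterhoff2014, Lemma 9.3.3] -/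
theorem exists_const_tendsto_deriv_wallJump_partner_noncompact_orbitMeasure
    (hα : ∀ i, α i ≠ 0) (hherm : ∀ i, (IsCMField.complexConj L (α i) : L) = α i)
    (ν : Measure (archLocal L 3 (Matrix.diagonal α) w)) [ν.IsHaarMeasure] [ν.IsMulRightInvariant]
    (ρ : Perm (Fin 3)) (hρ : (w.1.embedding (α (ρ⁻¹ 0))).re * (w.1.embedding (α (ρ⁻¹ 2))).re < 0)
    (z₁ : Fin 3 → Circle) (h02 : z₁ 0 = z₁ 2) (h01 : z₁ 0 ≠ z₁ 1)
    [MeasurableSpace (archLocal L 3 (Matrix.diagonal (α ∘ ⇑ρ⁻¹)) w ⧸ Subgroup.centralizer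
      ({(⟨circleDiagonal 3 z₁, circleDiagonal_mem_archLocal_diagonal L 3 (α ∘ ⇑ρ⁻¹) w z₁⟩ : archLocal L 3 (Matrix.diagonal (α ∘ ⇑ρ⁻¹)) w)} :
        Set (archLocal L 3 (Matrix.diagonal (α ∘ ⇑ρ⁻¹)) w)))]
    [BorelSpace (archLocal L 3 (Matrix.diagonal (α ∘ ⇑ρ⁻¹)) w ⧸ Subgroup.centralizer
      ({(⟨circleDiagonal 3 z₁, circleDiagonal_mem_archLocal_diagonal L 3 (α ∘ ⇑ρ⁻¹) w z₁⟩ : archLocal L 3 (Matrix.diagonal (α ∘ ⇑ρ⁻¹)) w)} :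
        Set (archLocal L 3 (Matrix.diagonal (α ∘ ⇑ρ⁻¹)) w)))]
    (νH : Measure (Subgroup.centralizer
      ({(⟨circleDiagonal 3 z₁, circleDiagonal_mem_archLocal_diagonal L 3 (α ∘ ⇑ρ⁻¹) w z₁⟩ : archLocal L 3 (Matrix.diagonal (α ∘ ⇑ρ⁻¹)) w)} :
        Set (archLocal L 3 (Matrix.diagonal (α ∘ ⇑ρ⁻¹)) w))))
    [νH.IsHaarMeasure] [νH.IsInvInvariant]
    [MeasurableSpace (arch (↥(maximalRealSubfield L)) L (IsCMField.complexConj L) 3 (Matrix.diagonal α))] [BorelSpace (arch (↥(maximalRealSubfield L)) L (IsCMField.complexConj L) 3 (Matrix.diagonal α))] :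
    haveI : LocallyCompactSpace (archLocal L 3 (Matrix.diagonal (α ∘ ⇑ρ⁻¹)) w) := locallyCompactSpace_archLocal L 3 (Matrix.diagonal (α ∘ ⇑ρ⁻¹)) w
    haveI : SecondCountableTopology (archLocal L 3 (Matrix.diagonal (α ∘ ⇑ρ⁻¹)) w) := secondCountableTopology_archLocal L 3 (Matrix.diagonal (α ∘ ⇑ρ⁻¹)) w
    haveI : (ν.map (ContinuousMulEquiv.restrictSubgroup (GLn.conjEquiv (Matrix.GeneralLinearGroup.mkOfDetNeZero _ (det_monomial_one_ne_zero 3 ρ⁻¹)))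
            (archLocal L 3 (Matrix.diagonal (α ∘ ⇑ρ⁻¹)) w) (archLocal L 3 (Matrix.diagonal α) w)
            (mem_archLocal_comp_perm_iff_conj_mem L 3 α w ρ⁻¹)).symm).IsMulRightInvariant := isMulRightInvariant_map_relabel_symm L 3 α w ρ⁻¹ ν
    haveI : (ν.map (ContinuousMulEquiv.restrictSubgroup (GLn.conjEquiv (Matrix.GeneralLinearGroup.mkOfDetNeZero _ (det_monomial_one_ne_zero 3 ρ⁻¹)))
            (archLocal L 3 (Matrix.diagonal (α ∘ ⇑ρ⁻¹)) w) (archLocal L 3 (Matrix.diagonal α) w)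
            (mem_archLocal_comp_perm_iff_conj_mem L 3 α w ρ⁻¹)).symm).IsHaarMeasure := ContinuousMulEquiv.isHaarMeasure_map ν _
    ∃ c : ℂ, c ≠ 0 ∧
      ∀ (Θ : Matrix (Fin 3) (Fin 3) (mixedSpace L) → ℂ), ContDiff ℝ (⊤ : ℕ∞) Θ →
        HasCompactSupport (fun g : arch (↥(maximalRealSubfield L)) L (IsCMField.complexConj L) 3 (Matrix.diagonal α) => Θ ((g : GL (Fin 3) (mixedSpace L)) : Matrix (Fin 3) (Fin 3) (mixedSpace L))) →
        ∀ (μall : ∀ v : {w : InfinitePlace L // IsComplex w}, Measure (archLocal L 3 (Matrix.diagonal α) v)) [∀ v, IsFiniteMeasureOnCompacts (μall v)] [∀ v, SigmaFinite (μall v)],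
        ∀ (z₀ : Fin 3 → Circle) (h02' : z₀ 0 = z₀ 2) (h01' : z₀ 0 ≠ z₀ 1),
          (∀ᶠ ψ in 𝓝[>] (0 : ℝ), DifferentiableAt ℝ (fun ψ : ℝ => (2 * Real.sin ψ : ℂ) *
              ∫ o, Θ ((((archPiEquivCM 3 L (Matrix.diagonal α)).symm o : arch (↥(maximalRealSubfield L)) L (IsCMField.complexConj L) 3 (Matrix.diagonal α)) : GL (Fin 3) (mixedSpace L)) : Matrix (Fin 3) (Fin 3) (mixedSpace L))
              ∂(Measure.pi (Function.update μall w (ν.map fun y : archLocal L 3 (Matrix.diagonal α) w => y * (⟨circleDiagonal 3 ((fun i => z₀ i * Circle.exp (![(1 : ℝ), 0, -1] i * ψ)) ∘ ⇑ρ), circleDiagonal_mem_archLocal_diagonal L 3 α w ((fun i => z₀ i * Circle.exp (![(1 : ℝ), 0, -1] i * ψ)) ∘ ⇑ρ)⟩ : archLocal L 3 (Matrix.diagonal α) w) * y⁻¹)))) ψ) ∧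
          Tendsto (fun ψ : ℝ => deriv (fun ψ : ℝ => (2 * Real.sin ψ : ℂ) *
              ∫ o, Θ ((((archPiEquivCM 3 L (Matrix.diagonal α)).symm o : arch (↥(maximalRealSubfield L)) L (IsCMField.complexConj L) 3 (Matrix.diagonal α)) : GL (Fin 3) (mixedSpace L)) : Matrix (Fin 3) (Fin 3) (mixedSpace L))
              ∂(Measure.pi (Function.update μall w (ν.map fun y : archLocal L 3 (Matrix.diagonal α) w => y * (⟨circleDiagonal 3 ((fun i => z₀ i * Circle.exp (![(1 : ℝ), 0, -1] i * ψ)) ∘ ⇑ρ), circleDiagonal_mem_archLocal_diagonal L 3 α w ((fun i => z₀ i * Circle.exp (![(1 : ℝ), 0, -1] i * ψ)) ∘ ⇑ρ)⟩ : archLocal L 3 (Matrix.diagonal α) w) * y⁻¹)))) ψ)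
            (𝓝[>] 0)
            (𝓝 (
                c * ∫ o, Θ ((((archPiEquivCM 3 L (Matrix.diagonal α)).symm o : arch (↥(maximalRealSubfield L)) L (IsCMField.complexConj L) 3 (Matrix.diagonal α)) : GL (Fin 3) (mixedSpace L)) : Matrix (Fin 3) (Fin 3) (mixedSpace L))
              ∂(Measure.pi (Function.update μall w (((quotientMeasure _ νH (isClosed_coe_centralizer_singleton _) (ν.map (ContinuousMulEquiv.restrictSubgroup (GLn.conjEquiv (Matrix.GeneralLinearGroup.mkOfDetNeZero _ (det_monomial_one_ne_zero 3 ρ⁻¹)))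
            (archLocal L 3 (Matrix.diagonal (α ∘ ⇑ρ⁻¹)) w) (archLocal L 3 (Matrix.diagonal α) w)
            (mem_archLocal_comp_perm_iff_conj_mem L 3 α w ρ⁻¹)).symm)).map
                (descConj (⟨circleDiagonal 3 z₀, circleDiagonal_mem_archLocal_diagonal L 3 (α ∘ ⇑ρ⁻¹) w z₀⟩ : archLocal L 3 (Matrix.diagonal (α ∘ ⇑ρ⁻¹)) w)
                  (Subgroup.centralizer ({(⟨circleDiagonal 3 z₁, circleDiagonal_mem_archLocal_diagonal L 3 (α ∘ ⇑ρ⁻¹) w z₁⟩ :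
                    archLocal L 3 (Matrix.diagonal (α ∘ ⇑ρ⁻¹)) w)} : Set (archLocal L 3 (Matrix.diagonal (α ∘ ⇑ρ⁻¹)) w)))
                  (forall_mem_centralizer_circleDiagonal_comm_of_wall L (α ∘ ⇑ρ⁻¹) w h02 h01 h02' h01') id)).map
                (ContinuousMulEquiv.restrictSubgroup (GLn.conjEquiv (Matrix.GeneralLinearGroup.mkOfDetNeZero _ (det_monomial_one_ne_zero 3 ρ⁻¹)))
            (archLocal L 3 (Matrix.diagonal (α ∘ ⇑ρ⁻¹)) w) (archLocal L 3 (Matrix.diagonal α) w)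
            (mem_archLocal_comp_perm_iff_conj_mem L 3 α w ρ⁻¹))))))) := by
  classical
  haveI hLC : LocallyCompactSpace (archLocal L 3 (Matrix.diagonal (α ∘ ⇑ρ⁻¹)) w) := locallyCompactSpace_archLocal L 3 (Matrix.diagonal (α ∘ ⇑ρ⁻¹)) w
  haveI hSC : SecondCountableTopology (archLocal L 3 (Matrix.diagonal (α ∘ ⇑ρ⁻¹)) w) := secondCountableTopology_archLocal L 3 (Matrix.diagonal (α ∘ ⇑ρ⁻¹)) w
  haveI hLCv : ∀ v : {w : InfinitePlace L // IsComplex w}, LocallyCompactSpace (archLocal L 3 (Matrix.diagonal α) v) := fun v => locallyCompactSpace_archLocal L 3 (Matrix.diagonal α) v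
  haveI hSCv : ∀ v : {w : InfinitePlace L // IsComplex w}, SecondCountableTopology (archLocal L 3 (Matrix.diagonal α) v) := fun v => secondCountableTopology_archLocal L 3 (Matrix.diagonal α) v
  have hreal : ∀ i, (w.1.embedding (α i)).im = 0 := fun i => im_embedding_eq_zero_of_complexConj_eq L w (hherm i)
  obtain ⟨c, hc, hJ1⟩ := exists_const_tendsto_deriv_wallJump_partner_noncompact L α w hα hreal ν ρ hρ z₁ h02 h01 νH
  refine ⟨c, hc, fun Θ hΘ hΘc μall _ _ z₀ h02' h01' => ?_⟩
  -- the mixed partial integral over the places `v ≠ w` is the restriction of a per-place test function `Θ'` (★ (R1-a))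
  obtain ⟨Θ', hΘ'd, hΘ'c, hΘ'eq⟩ := exists_contDiff_eq_integral_insert L 3 α hα w (fun w' : {v : {w : InfinitePlace L // IsComplex w} // ¬ v = w} => μall w'.1) Θ hΘ hΘc
  -- (D) the regularity window at `w`
  obtain ⟨ε, hε, hregε⟩ : ∃ ε > 0, ∀ ψ : ℝ, 0 < ψ → ψ < ε → ∀ ρ : Perm (Fin 3),
      Function.Injective ((fun i => z₀ i * Circle.exp (![(1 : ℝ), 0, -1] i * ψ)) ∘ ⇑ρ) := by
    have h := (eventually_injective_splitCurve z₀ h02' h01').filter_mono (nhdsWithin_mono _ fun x (hx : 0 < x) => ne_of_gt hx)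
    rw [eventually_nhdsWithin_iff, Metric.eventually_nhds_iff] at h
    obtain ⟨ε, hε, h⟩ := h
    exact ⟨ε, hε, fun ψ h0 hψε ρ => (h (by rw [Real.dist_eq, sub_zero, abs_of_pos h0]; exact hψε) h0).comp ρ.injective⟩
  -- (E) on the window the state is J1's function at `Θ'`
  have hpt : ∀ ψ : ℝ, 0 < ψ → ψ < ε →
      (fun ψ : ℝ => (2 * Real.sin ψ : ℂ) *
        ∫ o, Θ ((((archPiEquivCM 3 L (Matrix.diagonal α)).symm o : arch (↥(maximalRealSubfield L)) L (IsCMField.complexConj L) 3 (Matrix.diagonal α)) :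
            GL (Fin 3) (mixedSpace L)) : Matrix (Fin 3) (Fin 3) (mixedSpace L))
          ∂(Measure.pi (Function.update μall w (ν.map fun y : archLocal L 3 (Matrix.diagonal α) w =>
            y * (⟨circleDiagonal 3 ((fun i => z₀ i * Circle.exp (![(1 : ℝ), 0, -1] i * ψ)) ∘ ⇑ρ), circleDiagonal_mem_archLocal_diagonal L 3 α w ((fun i => z₀ i * Circle.exp (![(1 : ℝ), 0, -1] i * ψ)) ∘ ⇑ρ)⟩ : archLocal L 3 (Matrix.diagonal α) w) * y⁻¹)))) ψ =
      (fun ψ : ℝ => (2 * Real.sin ψ : ℂ) * ∫ g : archLocal L 3 (Matrix.diagonal α) w,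
        Θ' ((((g * ⟨circleDiagonal 3 ((fun i => z₀ i * Circle.exp (![(1 : ℝ), 0, -1] i * ψ)) ∘ ⇑ρ), circleDiagonal_mem_archLocal_diagonal L 3 α w _⟩ * g⁻¹ :
          archLocal L 3 (Matrix.diagonal α) w) : GL (Fin 3) ℂ) : Matrix (Fin 3) (Fin 3) ℂ)) ∂ν) ψ := by
    intro ψ h0 hψε
    simp only []
    congr 1
    refine integral_pi_update_map_conj_eq_integral L α w μall ν _ (fun C hC => ?_) Θ hΘ.continuous hΘc Θ' hΘ'd.continuous hΘ'eq
    exact isCompact_setOf_conj_circleDiagonal_mem_of_injective L 3 α w hα _ (hregε ψ h0 hψε ρ) C hC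
  -- (F) hence the derivatives agree near `0+`, and J1's limit transfers
  have hev : ∀ᶠ ψ in 𝓝[>] (0 : ℝ),
      deriv (fun ψ : ℝ => (2 * Real.sin ψ : ℂ) * ∫ g : archLocal L 3 (Matrix.diagonal α) w,
        Θ' ((((g * ⟨circleDiagonal 3 ((fun i => z₀ i * Circle.exp (![(1 : ℝ), 0, -1] i * ψ)) ∘ ⇑ρ), circleDiagonal_mem_archLocal_diagonal L 3 α w _⟩ * g⁻¹ :
          archLocal L 3 (Matrix.diagonal α) w) : GL (Fin 3) ℂ) : Matrix (Fin 3) (Fin 3) ℂ)) ∂ν) ψ =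
      deriv (fun ψ : ℝ => (2 * Real.sin ψ : ℂ) *
        ∫ o, Θ ((((archPiEquivCM 3 L (Matrix.diagonal α)).symm o : arch (↥(maximalRealSubfield L)) L (IsCMField.complexConj L) 3 (Matrix.diagonal α)) :
            GL (Fin 3) (mixedSpace L)) : Matrix (Fin 3) (Fin 3) (mixedSpace L))
          ∂(Measure.pi (Function.update μall w (ν.map fun y : archLocal L 3 (Matrix.diagonal α) w =>
            y * (⟨circleDiagonal 3 ((fun i => z₀ i * Circle.exp (![(1 : ℝ), 0, -1] i * ψ)) ∘ ⇑ρ), circleDiagonal_mem_archLocal_diagonal L 3 α w ((fun i => z₀ i * Circle.exp (![(1 : ℝ), 0, -1] i * ψ)) ∘ ⇑ρ)⟩ : archLocal L 3 (Matrix.diagonal α) w) * y⁻¹)))) ψ := by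
    filter_upwards [Ioo_mem_nhdsGT hε] with ψ hψ
    refine Filter.EventuallyEq.deriv_eq ?_
    filter_upwards [isOpen_Ioo.mem_nhds hψ] with ψ' hψ'
    exact (hpt ψ' hψ'.1 hψ'.2).symm
  refine ⟨?_, ?_⟩
  · -- differentiability on the window: there the state IS the per-place function at `Θ'`
    filter_upwards [Ioo_mem_nhdsGT hε] with ψ hψ
    have hloc : (fun ψ : ℝ => (2 * Real.sin ψ : ℂ) *
                ∫ o, Θ ((((archPiEquivCM 3 L (Matrix.diagonal α)).symm o : arch (↥(maximalRealSubfield L)) L (IsCMField.complexConj L) 3 (Matrix.diagonal α)) : GL (Fin 3) (mixedSpace L)) : Matrix (Fin 3) (Fin 3) (mixedSpace L))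
                ∂(Measure.pi (Function.update μall w (ν.map fun y : archLocal L 3 (Matrix.diagonal α) w => y * (⟨circleDiagonal 3 ((fun i => z₀ i * Circle.exp (![(1 : ℝ), 0, -1] i * ψ)) ∘ ⇑ρ), circleDiagonal_mem_archLocal_diagonal L 3 α w ((fun i => z₀ i * Circle.exp (![(1 : ℝ), 0, -1] i * ψ)) ∘ ⇑ρ)⟩ : archLocal L 3 (Matrix.diagonal α) w) * y⁻¹)))) =ᶠ[𝓝 ψ]
        (fun ψ : ℝ => (2 * Real.sin ψ : ℂ) * ∫ g : archLocal L 3 (Matrix.diagonal α) w,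
          Θ' ((((g * ⟨circleDiagonal 3 ((fun i => z₀ i * Circle.exp (![(1 : ℝ), 0, -1] i * ψ)) ∘ ⇑ρ), circleDiagonal_mem_archLocal_diagonal L 3 α w _⟩ * g⁻¹ :
            archLocal L 3 (Matrix.diagonal α) w) : GL (Fin 3) ℂ) : Matrix (Fin 3) (Fin 3) ℂ)) ∂ν) := by
      filter_upwards [isOpen_Ioo.mem_nhds hψ] with ψ' hψ'
      exact hpt ψ' hψ'.1 hψ'.2
    exact hloc.differentiableAt_iff.2 (((hJ1 Θ' hΘ'd hΘ'c z₀ h02' h01').1) ψ ((hregε ψ hψ.1 hψ.2 ρ).of_comp_right ρ.surjective))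
  have h2 := ((hJ1 Θ' hΘ'd hΘ'c z₀ h02' h01').2).congr' hev
  convert h2 using 2
  rw [integral_pi_update_singularOrbitMeasure_eq_integral_descConj L α w hα hherm μall ν ρ⁻¹ z₁ h02 h01 z₀ h02' h01' νH
      Θ hΘ.continuous hΘc Θ' hΘ'd.continuous hΘ'eq]

open scoped Classical in
/-- **THE ONE-STEP JUMP OF ONE COMPACT PARTNER AT `w`, ORBIT-MEASURE CURRENCY**: for every global test function `Θ`, every family `μ` of Radon measures on the `G_v`, every wall
point `z₀` and every `ρ` whose `w`-wall is COMPACT: `∂_ψ [2 sin ψ · I(μ[w ↦ ν.map conj_{diag(γ_{z₀}(ψ)∘ρ)}])] ⟶ 2 · I(μ[w ↦ ν.map conj_{diag(z₀∘ρ)}])` as `ψ → 0+`, the state being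
differentiable on the window (★ (R1-e′)'s proof for one partner: mixed partial test function ★ (R1-a), §2's compact jump, read back by ★ `integral_pi_update_map_conj_eq_integral`).
[cite: Rogawski1990, §8.2 pp. 122–124; §14.5 p. 238] [cite: BorelJacquet1979, §4.1] -/
theorem tendsto_deriv_wallJump_partner_compact_orbitMeasure
    (hα : ∀ i, α i ≠ 0) (hherm : ∀ i, (IsCMField.complexConj L (α i) : L) = α i)
    (ν : Measure (archLocal L 3 (Matrix.diagonal α) w)) [ν.IsHaarMeasure] [ν.IsMulRightInvariant]
    [MeasurableSpace (arch (↥(maximalRealSubfield L)) L (IsCMField.complexConj L) 3 (Matrix.diagonal α))] [BorelSpace (arch (↥(maximalRealSubfield L)) L (IsCMField.complexConj L) 3 (Matrix.diagonal α))]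
    (Θ : Matrix (Fin 3) (Fin 3) (mixedSpace L) → ℂ) (hΘ : ContDiff ℝ (⊤ : ℕ∞) Θ)
    (hΘc : HasCompactSupport (fun g : arch (↥(maximalRealSubfield L)) L (IsCMField.complexConj L) 3 (Matrix.diagonal α) => Θ ((g : GL (Fin 3) (mixedSpace L)) : Matrix (Fin 3) (Fin 3) (mixedSpace L))))
    (μall : ∀ v : {w : InfinitePlace L // IsComplex w}, Measure (archLocal L 3 (Matrix.diagonal α) v)) [∀ v, IsFiniteMeasureOnCompacts (μall v)] [∀ v, SigmaFinite (μall v)]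
    (z₀ : Fin 3 → Circle) (h02' : z₀ 0 = z₀ 2) (h01' : z₀ 0 ≠ z₀ 1) (ρ : Perm (Fin 3))
    (hρ : 0 < (w.1.embedding (α (ρ⁻¹ 0))).re * (w.1.embedding (α (ρ⁻¹ 2))).re) :
          (∀ᶠ ψ in 𝓝[>] (0 : ℝ), DifferentiableAt ℝ (fun ψ : ℝ => (2 * Real.sin ψ : ℂ) *
              ∫ o, Θ ((((archPiEquivCM 3 L (Matrix.diagonal α)).symm o : arch (↥(maximalRealSubfield L)) L (IsCMField.complexConj L) 3 (Matrix.diagonal α)) : GL (Fin 3) (mixedSpace L)) : Matrix (Fin 3) (Fin 3) (mixedSpace L))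
              ∂(Measure.pi (Function.update μall w (ν.map fun y : archLocal L 3 (Matrix.diagonal α) w => y * (⟨circleDiagonal 3 ((fun i => z₀ i * Circle.exp (![(1 : ℝ), 0, -1] i * ψ)) ∘ ⇑ρ), circleDiagonal_mem_archLocal_diagonal L 3 α w ((fun i => z₀ i * Circle.exp (![(1 : ℝ), 0, -1] i * ψ)) ∘ ⇑ρ)⟩ : archLocal L 3 (Matrix.diagonal α) w) * y⁻¹)))) ψ) ∧
          Tendsto (fun ψ : ℝ => deriv (fun ψ : ℝ => (2 * Real.sin ψ : ℂ) *
              ∫ o, Θ ((((archPiEquivCM 3 L (Matrix.diagonal α)).symm o : arch (↥(maximalRealSubfield L)) L (IsCMField.complexConj L) 3 (Matrix.diagonal α)) : GL (Fin 3) (mixedSpace L)) : Matrix (Fin 3) (Fin 3) (mixedSpace L))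
              ∂(Measure.pi (Function.update μall w (ν.map fun y : archLocal L 3 (Matrix.diagonal α) w => y * (⟨circleDiagonal 3 ((fun i => z₀ i * Circle.exp (![(1 : ℝ), 0, -1] i * ψ)) ∘ ⇑ρ), circleDiagonal_mem_archLocal_diagonal L 3 α w ((fun i => z₀ i * Circle.exp (![(1 : ℝ), 0, -1] i * ψ)) ∘ ⇑ρ)⟩ : archLocal L 3 (Matrix.diagonal α) w) * y⁻¹)))) ψ)
            (𝓝[>] 0)
            (𝓝 (
                2 * ∫ o, Θ ((((archPiEquivCM 3 L (Matrix.diagonal α)).symm o : arch (↥(maximalRealSubfield L)) L (IsCMField.complexConj L) 3 (Matrix.diagonal α)) : GL (Fin 3) (mixedSpace L)) : Matrix (Fin 3) (Fin 3) (mixedSpace L))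
              ∂(Measure.pi (Function.update μall w (ν.map fun y : archLocal L 3 (Matrix.diagonal α) w => y * (⟨circleDiagonal 3 (z₀ ∘ ⇑ρ), circleDiagonal_mem_archLocal_diagonal L 3 α w (z₀ ∘ ⇑ρ)⟩ : archLocal L 3 (Matrix.diagonal α) w) * y⁻¹))))) := by
  classical
  haveI hLC : ∀ τ : Perm (Fin 3), LocallyCompactSpace (archLocal L 3 (Matrix.diagonal (α ∘ ⇑τ)) w) :=
    fun τ => locallyCompactSpace_archLocal L 3 (Matrix.diagonal (α ∘ ⇑τ)) w
  haveI hSC : ∀ τ : Perm (Fin 3), SecondCountableTopology (archLocal L 3 (Matrix.diagonal (α ∘ ⇑τ)) w) :=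
    fun τ => secondCountableTopology_archLocal L 3 (Matrix.diagonal (α ∘ ⇑τ)) w
  haveI hLCv : ∀ v : {w : InfinitePlace L // IsComplex w}, LocallyCompactSpace (archLocal L 3 (Matrix.diagonal α) v) := fun v => locallyCompactSpace_archLocal L 3 (Matrix.diagonal α) v
  haveI hSCv : ∀ v : {w : InfinitePlace L // IsComplex w}, SecondCountableTopology (archLocal L 3 (Matrix.diagonal α) v) := fun v => secondCountableTopology_archLocal L 3 (Matrix.diagonal α) v
  have hreal : ∀ i, (w.1.embedding (α i)).im = 0 := fun i => im_embedding_eq_zero_of_complexConj_eq L w (hherm i)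
  have hJ1 := tendsto_deriv_wallJump_partner_compact L α w hα hreal ν
  -- the mixed partial integral over the places `v ≠ w` is the restriction of a per-place test function `Θ'` (★ (R1-a))
  obtain ⟨Θ', hΘ'd, hΘ'c, hΘ'eq⟩ := exists_contDiff_eq_integral_insert L 3 α hα w (fun w' : {v : {w : InfinitePlace L // IsComplex w} // ¬ v = w} => μall w'.1) Θ hΘ hΘc
  -- (D) the regularity window at `w`
  obtain ⟨ε, hε, hregε⟩ : ∃ ε > 0, ∀ ψ : ℝ, 0 < ψ → ψ < ε → ∀ ρ : Perm (Fin 3),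
      Function.Injective ((fun i => z₀ i * Circle.exp (![(1 : ℝ), 0, -1] i * ψ)) ∘ ⇑ρ) := by
    have h := (eventually_injective_splitCurve z₀ h02' h01').filter_mono (nhdsWithin_mono _ fun x (hx : 0 < x) => ne_of_gt hx)
    rw [eventually_nhdsWithin_iff, Metric.eventually_nhds_iff] at h
    obtain ⟨ε, hε, h⟩ := h
    exact ⟨ε, hε, fun ψ h0 hψε ρ => (h (by rw [Real.dist_eq, sub_zero, abs_of_pos h0]; exact hψε) h0).comp ρ.injective⟩
  -- (E) on the window the state is J1's function at `Θ'`
  have hpt : ∀ ψ : ℝ, 0 < ψ → ψ < ε →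
      (fun ψ : ℝ => (2 * Real.sin ψ : ℂ) *
        ∫ o, Θ ((((archPiEquivCM 3 L (Matrix.diagonal α)).symm o : arch (↥(maximalRealSubfield L)) L (IsCMField.complexConj L) 3 (Matrix.diagonal α)) :
            GL (Fin 3) (mixedSpace L)) : Matrix (Fin 3) (Fin 3) (mixedSpace L))
          ∂(Measure.pi (Function.update μall w (ν.map fun y : archLocal L 3 (Matrix.diagonal α) w =>
            y * (⟨circleDiagonal 3 ((fun i => z₀ i * Circle.exp (![(1 : ℝ), 0, -1] i * ψ)) ∘ ⇑ρ), circleDiagonal_mem_archLocal_diagonal L 3 α w ((fun i => z₀ i * Circle.exp (![(1 : ℝ), 0, -1] i * ψ)) ∘ ⇑ρ)⟩ : archLocal L 3 (Matrix.diagonal α) w) * y⁻¹)))) ψ =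
      (fun ψ : ℝ => (2 * Real.sin ψ : ℂ) * ∫ g : archLocal L 3 (Matrix.diagonal α) w,
        Θ' ((((g * ⟨circleDiagonal 3 ((fun i => z₀ i * Circle.exp (![(1 : ℝ), 0, -1] i * ψ)) ∘ ⇑ρ), circleDiagonal_mem_archLocal_diagonal L 3 α w _⟩ * g⁻¹ :
          archLocal L 3 (Matrix.diagonal α) w) : GL (Fin 3) ℂ) : Matrix (Fin 3) (Fin 3) ℂ)) ∂ν) ψ := by
    intro ψ h0 hψε
    simp only []
    congr 1
    refine integral_pi_update_map_conj_eq_integral L α w μall ν _ (fun C hC => ?_) Θ hΘ.continuous hΘc Θ' hΘ'd.continuous hΘ'eq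
    exact isCompact_setOf_conj_circleDiagonal_mem_of_injective L 3 α w hα _ (hregε ψ h0 hψε ρ) C hC
  -- (F) hence the derivatives agree near `0+`, and J1's limit transfers
  have hev : ∀ᶠ ψ in 𝓝[>] (0 : ℝ),
      deriv (fun ψ : ℝ => (2 * Real.sin ψ : ℂ) * ∫ g : archLocal L 3 (Matrix.diagonal α) w,
        Θ' ((((g * ⟨circleDiagonal 3 ((fun i => z₀ i * Circle.exp (![(1 : ℝ), 0, -1] i * ψ)) ∘ ⇑ρ), circleDiagonal_mem_archLocal_diagonal L 3 α w _⟩ * g⁻¹ :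
          archLocal L 3 (Matrix.diagonal α) w) : GL (Fin 3) ℂ) : Matrix (Fin 3) (Fin 3) ℂ)) ∂ν) ψ =
      deriv (fun ψ : ℝ => (2 * Real.sin ψ : ℂ) *
        ∫ o, Θ ((((archPiEquivCM 3 L (Matrix.diagonal α)).symm o : arch (↥(maximalRealSubfield L)) L (IsCMField.complexConj L) 3 (Matrix.diagonal α)) :
            GL (Fin 3) (mixedSpace L)) : Matrix (Fin 3) (Fin 3) (mixedSpace L))
          ∂(Measure.pi (Function.update μall w (ν.map fun y : archLocal L 3 (Matrix.diagonal α) w =>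
            y * (⟨circleDiagonal 3 ((fun i => z₀ i * Circle.exp (![(1 : ℝ), 0, -1] i * ψ)) ∘ ⇑ρ), circleDiagonal_mem_archLocal_diagonal L 3 α w ((fun i => z₀ i * Circle.exp (![(1 : ℝ), 0, -1] i * ψ)) ∘ ⇑ρ)⟩ : archLocal L 3 (Matrix.diagonal α) w) * y⁻¹)))) ψ := by
    filter_upwards [Ioo_mem_nhdsGT hε] with ψ hψ
    refine Filter.EventuallyEq.deriv_eq ?_
    filter_upwards [isOpen_Ioo.mem_nhds hψ] with ψ' hψ'
    exact (hpt ψ' hψ'.1 hψ'.2).symm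
  refine ⟨?_, ?_⟩
  · -- differentiability on the window: there the state IS the per-place function at `Θ'`
    filter_upwards [Ioo_mem_nhdsGT hε] with ψ hψ
    have hloc : (fun ψ : ℝ => (2 * Real.sin ψ : ℂ) *
                ∫ o, Θ ((((archPiEquivCM 3 L (Matrix.diagonal α)).symm o : arch (↥(maximalRealSubfield L)) L (IsCMField.complexConj L) 3 (Matrix.diagonal α)) : GL (Fin 3) (mixedSpace L)) : Matrix (Fin 3) (Fin 3) (mixedSpace L))
                ∂(Measure.pi (Function.update μall w (ν.map fun y : archLocal L 3 (Matrix.diagonal α) w => y * (⟨circleDiagonal 3 ((fun i => z₀ i * Circle.exp (![(1 : ℝ), 0, -1] i * ψ)) ∘ ⇑ρ), circleDiagonal_mem_archLocal_diagonal L 3 α w ((fun i => z₀ i * Circle.exp (![(1 : ℝ), 0, -1] i * ψ)) ∘ ⇑ρ)⟩ : archLocal L 3 (Matrix.diagonal α) w) * y⁻¹)))) =ᶠ[𝓝 ψ]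
        (fun ψ : ℝ => (2 * Real.sin ψ : ℂ) * ∫ g : archLocal L 3 (Matrix.diagonal α) w,
          Θ' ((((g * ⟨circleDiagonal 3 ((fun i => z₀ i * Circle.exp (![(1 : ℝ), 0, -1] i * ψ)) ∘ ⇑ρ), circleDiagonal_mem_archLocal_diagonal L 3 α w _⟩ * g⁻¹ :
            archLocal L 3 (Matrix.diagonal α) w) : GL (Fin 3) ℂ) : Matrix (Fin 3) (Fin 3) ℂ)) ∂ν) := by
      filter_upwards [isOpen_Ioo.mem_nhds hψ] with ψ' hψ'
      exact hpt ψ' hψ'.1 hψ'.2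
    exact hloc.differentiableAt_iff.2 (((hJ1 Θ' hΘ'd hΘ'c z₀ h02' h01' ρ hρ).1) ψ ((hregε ψ hψ.1 hψ.2 ρ).of_comp_right ρ.surjective))
  have h2 := ((hJ1 Θ' hΘ'd hΘ'c z₀ h02' h01' ρ hρ).2).congr' hev
  convert h2 using 2
  rw [integral_pi_update_map_conj_eq_integral L α w μall ν _ (fun C hC =>
    isCompact_setOf_conj_circleDiagonal_comp_perm_mem_of_compactWall L α w hα hreal z₀ h02' h01' ρ hρ C hC) Θ hΘ.continuous hΘc Θ' hΘ'd.continuous hΘ'eq]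

end Step

end Summit.HodgeConjecture.HodgeConjecture.Cruxes.H413.K2E4ArchPartnerWallJumpOrbitMeasure

end
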